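import Literature.AlgebraicGeometry.Frobenioids.ModelFrobenioidBirational
import Literature.AnabelianGeometry.EtaleTheta.TemperedFrobenioidModel
import Literature.AnabelianGeometry.EtaleTheta.ThetaFrobenioidOfModel
import Literature.AnabelianGeometry.EtaleTheta.FrobenioidThetaBiKummer

/-!
# [EtTh] §5 merge adapter II: the §5 stubs over abc-iut-L2-t3's tempered Frobenioid

Mochizuki, *The étale theta function and its Frobenioid-theoretic manifestations*, Publ. RIMS **45**
(2009), §5 pp. 322–326 (PDF pp. 96–100) [cite: MochizukiEtTh2009, Prop 5.1 p.323 (PDF p.97)].  abc-iut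
cell, layer L2, unit W2-L2-05 (merge adapter t3/found/L1 → t4), seat abc-iut-L2-t9.

The §5 statements of abc-iut-L2-t4 (`FrobenioidTheta*.lean`) quantify over a `ThetaFrobenioid C D` whose
Frobenioid-level part is the stub `TemperedFrobenioidStub C D`, over the Proposition 5.1 vocabulary stub
`FrobenioidThetaBiKummer.TemperedVocabStub` and over the divisor data stub
`FrobenioidThetaDivisors.DivisorPrimeData` — each tagged `TODO-merge(abc-iut-L2-t3 / abc-iut-found)`.
[EtTh] §5 opens "We return to the situation of Example 3.9 … a tempered Frobenioid `C` of monoid type `ℤ`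
over the base category `D`" (p.322 (PDF p.96)); a tempered Frobenioid is the model Frobenioid of
abc-iut-L2-t3's data `C₀ : TemperedFrobenioid T D VD` (Def. 3.6 (ii); `C₀.category`,
`TemperedFrobenioidModel.lean`).  This file instantiates the first two stubs FOR `C = C₀.category` from `C₀`
and the tree, recording exactly which inputs remain primitive:

* `TemperedFrobenioid.thetaStub C₀` — `TemperedFrobenioidStub C₀.category D`: all fields real
  (`ThetaFrobenioidOfModel.lean`) except the parameter `IsBFT` (Def. 4.1 (iv), `TODO-merge(abc-iut-L2-t3:
  BiKummerSetting.IsOfBaseFrobeniusType; abc-iut-L1-t2: [FrdI] Def. 2.7 (iii))`);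
* `TemperedFrobenioid.thetaVocab C₀` — `TemperedVocabStub 𝔉` for any §5 data `𝔉` over `C₀.category`:
  "tempered Frobenioid" := `𝔉`'s Frobenioid-level part IS `C₀.thetaStub`; "slim base" := the tree's
  `IsSlim D`; "monoid type `ℤ`", "perfect", "perf-factorial", "cuspidally pure" := abc-iut-L2-t3's
  Def. 3.6 notions for `C₀`; "non-dilating" := found's `IsNonDilatingOn C₀.divisorMonoid`; the three
  clauses whose vocabulary is not in the tree ("rationally standard type" = [FrdI] Def. 4.5 (iii), the
  hypothesis packages of Cor. 3.8 and Thm. 4.4 = abc-iut-L2-t3's `Cor38Hyp`/`Thm44Hyp` over their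
  `FrobenioidFacade`/`BiKummerSetting`) stay the parameters `VocabParams` (`TODO-merge(abc-iut-L2-t3,
  abc-iut-L1-t3)`); `applicability_of_model` then reduces Proposition 5.1 for the model to these inputs,
  discharging the "tempered" and "perf-factorial" clauses outright;
* (Proposition 5.3's `DivisorPrimeData` for the model — `Φ(A_⊚) := Φ(A_⊚^bs)`, the `Aut_C(A_⊚)`-action
  through `Aut_D(A_⊚^bs)` (`ModelFrobenioid.divisorActGp`), cuspidality from Def. 3.6 (iii), the special-fibre
  data as parameters — follows in the companion file `ThetaDivisorsOfTempered.lean`, behind abc-iut-L2-t4's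
  `FrobenioidThetaDivisors.lean`.)

Not instantiated here (reported, abc-iut-L2-t9 NOTES/STATUS): `ThetaSubquotientStub D` (the subquotients
`(l·Δ_Θ)_E ⊆ Aut_D(E)`, p.327 (PDF p.101): needs `D = B^temp(Π^tp_X)⁰` concretely — abc-iut-L3-t2's
`SemiGraphs.BTemp` and `OncePuncturedTemperedGroup.deltaTheta`) and `BiKummerVocabStub` (Prop. 4.2 (iii)
roots of fraction-pairs: abc-iut-L2-t3's `BiKummerSetting.NthRoot` over the setting `BiKummerSetting.mkOfModel`
of `BiKummerOfModel.lean`; best re-typed by the consumer over those real structures).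
HONEST FRAMING: constructions over abc-iut-L2-t3's DATA structure and abc-iut-L2-t4's §5 DATA; nothing
asserts these data exist for an actual curve; Proposition 5.1 is not proved here; typed ≠ proved.
-/

noncomputable section

namespace Literature.AnabelianGeometry.EtaleTheta

namespace TemperedFrobenioid

open CategoryTheory Opposite Literature.AlgebraicGeometry.Frobenioids FrobenioidTheta

universe u₀ v₀ u v w

variable {D₀ : Type u₀} [Category.{v₀} D₀] {V : FrdIMonoidStub.{w}}
  {T : RealifiedDivisorMonoids (D₀ := D₀) V} {D : Type u} [Category.{v} D]
  {VD : FrdICatStub.{u, v, w} D} (C₀ : TemperedFrobenioid T D VD)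

/-! ### The Frobenioid-level §5 stub of the tempered Frobenioid `C₀.category` -/

/-- **The §5 Frobenioid-level vocabulary of a tempered Frobenioid** ("a tempered Frobenioid `C` of monoid
type `ℤ` over the base category `D`", §5 p.322 (PDF p.96)) for `C = C₀.category`, the model Frobenioid of
abc-iut-L2-t3's data (Def. 3.6 (ii)): `TemperedFrobenioidStub.ofModel` for `(D, Φ, B, B → Φ^gp) =
(D, C₀.divisorMonoid, C₀.ratFnFunctor, C₀.divBNatTrans)`.  Parameters: `hΦ` — `Φ(A)` integral for every
`A` (divisorial, [FrdI] Def. 1.1 (i); abc-iut-L2-t3 carries divisoriality as `VD.IsDivisorialOn`); `IsBFT`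
— morphisms of base-Frobenius type (Def. 4.1 (iv); `TODO-merge(abc-iut-L2-t3, abc-iut-L1-t2)`).
[cite: MochizukiEtTh2009, §5 p.322 (PDF p.96)] -/
def thetaStub (hΦ : ∀ A : Dᵒᵖ, IsIntegral (C₀.Φ.carrier A)) (IsBFT : MorphismProperty C₀.category) :
    TemperedFrobenioidStub.{w} C₀.category D :=
  TemperedFrobenioidStub.ofModel C₀.divisorMonoid C₀.ratFnFunctor C₀.divBNatTrans hΦ IsBFT

/-- `O^×(S^birat)` of the tempered Frobenioid is `B(S^bs)^×`, `B = B₀^Λ|_D ×_{(Φ^{ℝ-log})^gp} Φ^gp`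
(Def. 3.6 (ii); [FrdI] Thm. 5.2 (ii)). [cite: MochizukiEtTh2009, Def 3.6 p.303 (PDF p.77)] -/
theorem thetaStub_biratUnits (hΦ : ∀ A : Dᵒᵖ, IsIntegral (C₀.Φ.carrier A))
    (IsBFT : MorphismProperty C₀.category) (S : C₀.category) :
    (C₀.thetaStub hΦ IsBFT).biratUnits S = (C₀.ratFn (op S.base))ˣ := rfl

/-! ### Proposition 5.1's vocabulary for the model -/

/-- The clauses of Proposition 5.1 whose vocabulary the tree does not yet define for a CATEGORY, carried
as parameters: "of rationally standard type" ([FrdI] Def. 4.5 (iii); abc-iut-L2-t3's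
`FrobenioidFacade.IsOfRationallyStandardType`, abc-iut-L1-t3's §4), "all of the hypotheses of Corollary
3.8, (i), (ii), (iii)" and "… Theorem 4.4" (abc-iut-L2-t3's `Cor38Hyp`, `Thm44Hyp`, typed over their
hypothesis structures `FrobenioidFacade`, `BiKummerSetting`).  `TODO-merge(abc-iut-L2-t3, abc-iut-L1-t3)`.
[cite: MochizukiEtTh2009, Prop 5.1 p.323 (PDF p.97)] -/
structure VocabParams where
  /-- "`C` is … of rationally standard type" ([FrdI] Def. 4.5 (iii)). -/
  IsRationallyStandard : Prop
  /-- "`C` and `Ψ` satisfy all of the hypotheses of Corollary 3.8, (i), (ii), (iii)". -/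
  HypothesesCor38 : (C₀.category ≌ C₀.category) → Prop
  /-- "… Theorem 4.4 [for '`C₁`', '`C₂`', '`Ψ : C₁ ⥲ C₂`']". -/
  HypothesesThm44 : (C₀.category ≌ C₀.category) → Prop

variable {C₀}

/-- **Proposition 5.1's vocabulary** (abc-iut-L2-t4's `TemperedVocabStub`) for §5 data `𝔉` over the model
of the tempered Frobenioid `C₀`: "`C` is a tempered Frobenioid" := the Frobenioid-level part of `𝔉` IS the
one of `C₀` (`∃ hΦ IsBFT, 𝔉.toTemperedFrobenioidStub = C₀.thetaStub hΦ IsBFT`); "over a slim base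
category `D`" := `IsSlim D` ([FrdI] §0, tree); "whose monoid type is `ℤ`" := `C₀.monoidType = ℤ`
(Def. 3.6 (ii)); "whose divisor monoid `Φ(−)` is perfect" := every `Φ(A)` perfect ([FrdI] §0, tree);
"perf-factorial" := as in Def. 3.6 (ii) (abc-iut-L2-t3's vocabulary `V`); "non-dilating" := found's
`IsNonDilatingOn` ([FrdI] Def. 1.1 (ii)); "cuspidally pure" := Def. 3.6 (v) (abc-iut-L2-t3); the rest
from `P`. [cite: MochizukiEtTh2009, Prop 5.1 p.323 (PDF p.97)] -/
def thetaVocab (𝔉 : ThetaFrobenioid.{w} C₀.category D) (P : C₀.VocabParams) :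
    FrobenioidThetaBiKummer.TemperedVocabStub 𝔉 where
  IsTemperedFrobenioid := ∃ (hΦ : ∀ A : Dᵒᵖ, IsIntegral (C₀.Φ.carrier A))
    (IsBFT : MorphismProperty C₀.category), 𝔉.toTemperedFrobenioidStub = C₀.thetaStub hΦ IsBFT
  IsRationallyStandard := P.IsRationallyStandard
  IsSlimBase := IsSlim D
  IsMonoidTypeZ := C₀.monoidType = MonoidType.Z
  IsPerfect := ∀ A : Dᵒᵖ, IsPerfect (C₀.Φ.carrier A)
  IsPerfFactorial := ∀ A : Dᵒᵖ, V.IsPerfFactorial (C₀.Φ.carrier A)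
  IsNonDilating := IsNonDilatingOn C₀.divisorMonoid
  IsCuspidallyPure := C₀.IsCuspidallyPure
  HypothesesCor38 := P.HypothesesCor38
  HypothesesThm44 := P.HypothesesThm44

/-- **Proposition 5.1 for the model, reduced to its inputs.**  For §5 data `𝔉` whose Frobenioid-level
part is that of the tempered Frobenioid `C₀`, Proposition 5.1 ("`C` is a tempered Frobenioid of
rationally standard type over a slim base category `D`, whose monoid type is `ℤ`, and whose divisor
monoid `Φ(−)` is perfect, perf-factorial, non-dilating, and cuspidally pure. In particular, `C` and …
`Ψ` satisfy all of the hypotheses of Corollary 3.8, (i), (ii), (iii); Theorem 4.4") HOLDS in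
abc-iut-L2-t4's typing as soon as the listed properties of `C₀` hold — "tempered" by construction and
"perf-factorial" by Def. 3.6 (ii) (`C₀.isPerfFactorial`).  This is the §5 reading "it follows from
Example 3.9, (iv), that we have the following" with Example 3.9 (iv)'s facts as the hypotheses.
[cite: MochizukiEtTh2009, Prop 5.1 p.323 (PDF p.97)] -/
theorem applicability_of_model (𝔉 : ThetaFrobenioid.{w} C₀.category D) (P : C₀.VocabParams)
    {hΦ : ∀ A : Dᵒᵖ, IsIntegral (C₀.Φ.carrier A)} {IsBFT : MorphismProperty C₀.category}
    (h𝔉 : 𝔉.toTemperedFrobenioidStub = C₀.thetaStub hΦ IsBFT) (Ψ : C₀.category ≌ C₀.category)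
    (hrs : P.IsRationallyStandard) (hslim : IsSlim D) (hZ : C₀.monoidType = MonoidType.Z)
    (hperf : ∀ A : Dᵒᵖ, IsPerfect (C₀.Φ.carrier A)) (hnd : IsNonDilatingOn C₀.divisorMonoid)
    (hcp : C₀.IsCuspidallyPure) (h38 : P.HypothesesCor38 Ψ) (h44 : P.HypothesesThm44 Ψ) :
    FrobenioidThetaBiKummer.ApplicabilityOfGeneralTheory 𝔉 (thetaVocab 𝔉 P) Ψ where
  tempered := ⟨hΦ, IsBFT, h𝔉⟩
  rationallyStandard := hrs
  slimBase := hslim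
  monoidTypeZ := hZ
  perfect := hperf
  perfFactorial := C₀.isPerfFactorial
  nonDilating := hnd
  cuspidallyPure := hcp
  hypothesesCor38 := h38
  hypothesesThm44 := h44

end TemperedFrobenioid

end Literature.AnabelianGeometry.EtaleTheta
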